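import Summits.QuantumFields.BalabanUV.T4Continuum.Support.NE7EnergyRateWGenericL
import Summits.QuantumFields.BalabanUV.T4Continuum.Support.NE7PairDecompNL0SupGeneric
import Summits.QuantumFields.BalabanUV.T4Continuum.Support.NE7PairCovGradRate40Generic
import Summits.QuantumFields.BalabanUV.T4Continuum.Support.NE7EnergyGradRateWSU2Log
import HarnessLib

/-!
# NE7EnergyGradRateWLogGeneric — PORT MAP P3.6d: gen 108's `NE7EnergyGradRateWSU2Log.ne3EnergyGradRateWSup_SU2_log` AT `d = 4`, ANY BLOCK SIZE `L ≥ 2`, ANY `U(n)` — T-E_w♯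
# TOGETHER WITH THE COVARIANT-GRADIENT RATE (Gᶜ_w) FROM THE LOG-TOLERANT (10)-TYPE LETTERS `‖∇_U F‖ ≤ c·(1+k)∕(L^k)³` OF THE TWO MINIMISERS, modulo the class slice-Poincaré
# inequality of `𝒯_E` and the class level family AT BLOCK SIZE `L` (discharged by `classPackage` in P3.6e `NE7EnergyGradRateWLogGenericEnd`); conclusion `Λ_G·θ^{38k}`,
# `θ^{18} = L⁻¹`, k-free `Λ_G`

Cell `pub-balaban`, rung (B)+1 sub-cell t4, lineage `b2b-balaban-t4-ne7b-p1` (row NE7b OWNER + CRUX PROVER), generation 156 — PORT MAP item P3.6d of the road t4-ne7-p1 g109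
([NE7P1-G109-INBOX-3]; memo `t4/b2b-balaban-t4-ne7-p1-g109/ROAD-G109.md` §3, recipe `2 ↦ L`), claimed [NE7bP1-G156-INBOX-6].  Steps (0)–(11) = P3.5
`NE7EnergyRateWGenericL.ne3EnergyRateWSup_of_classPoincare_L` verbatim over P3.6c `decomp_of_nl0_pair_sup_generic` (the two sup letters of `X_N` exported); step (12) = gen 108's
(Gᶜ_w) assembly under the recipe over the road's ✓ p810907 `NE7PairCovGradRate40Generic.covGrad_rate_le_generic` (target exponent `40`), `NE7EtaRatesD4.energy_budget_of_residualScale`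
(`L^{j+1}·E ≤ γ_E³`), `NE3AveragedGradientRadius.norm_plaqGrad_cavg_le_of_regularSup` ((Rb) line `2¹⁵·5²·8²·L²·ε ≤ 1` folded into `ε₀`), `NE3FluxGradientDictionary`, and
`NE7CovGradBootstrapAlgebra.sq_two_add_rate ∕ rate_plain` (`(2+k)²θ^{40k} ≤ 4D²θ^{38k}`).  RESULT `Λ_G = 128K_Gl₀²γ_ED³ + 2²⁷(C_Sε)²K_G³γ_E³D³ + 2(K_Gc_Nγ_E⁶D + 2c_Nγ_E⁶)`, `D = (1−θ)⁻¹`.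
WHAT ([folklore]; 0 def, 0 sorry).  **`ne3EnergyGradRateWSup_log_L`** (displays: the `𝒯_E` class Poincaré constant on `sfClass 4 L N ε (j+1)` for `ε ≤ ε₁`, the level family for
`ε ≤ ε₁`, the cap `512·5·8·L²·ε₁ ≤ 1`; competitor line `b + 226·320²·L²·b² ≤ ε`).
HONEST FRAMING (page 1): composition of landed kernel theorems of rows NE3, NE7, NE7b and of [B7]∕[B8]∕[B11] AS TYPED; the log-tolerant flux-gradient letters are HYPOTHESES here
(theorems for every minimiser over the small data by P3.7 `NE7AllMinimisersFluxGradGeneric`); nothing of Bałaban's asserted as an axiom; constants existential; NOT NE3∕NE7 as spine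
nodes; row NE7b (`T4WeightBudget.RelWeightBound`) NOT PRINTED ∕ NOT PROVED; spine count = dagwriter∕referees' call; finite T⁴ rung (B)+1 — NOT infinite volume, NOT mass gap, NOT
BetaPertH, NOT Clay (continuum YM on T⁴ ⇐ BetaPertH ∧ nine spine estimates).
-/

set_option autoImplicit false

open scoped BigOperators Matrix Matrix.Norms.L2Operator
open NormedSpace Finset Set

namespace Summit.QuantumFields.BalabanUV.T4Continuum.NE7EnergyGradRateWLogGeneric

open Literature.MathematicalPhysics.QuantumFieldTheory.Balaban1983to89
open B7Prop1Explicit B7Prop2Explicit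
open T4AveragingDeficitWall (IsUnitaryCfg IsSkewDir SmallField fineAction vary curl curlSq dirSq)
open T4AveragingDeficitWallBoundary (IsPeriodicCfg periodBox)
open T4ConvexResponse (taylor_lower)
open AveragingDeficitPeriodicCounting (IsPeriodicDir)
open AveragingDeficitDerivWallProof (wallConst wallConst_nonneg)
open AveragingDeficitDualResidual (dualC2 dualC1)
open AveragingDeficitChartCalculus (cavg)
open AveragingDeficitMultiLevelPrep (LevelSmall tower)
open MinimalActionLevels (perWin levelAction stepWt_pos)
open MinimalActionSandwich (IsMinimiser admissible)
open MinimalActionRate (sfClass Regular)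
open NE3HessForm (dAction hess segment_derivData)
open NE3EnergyShapes (IsUnitarySite IsPeriodicSite residualScale residualScale_nonneg dualC1_nonneg dualC2_nonneg)
open NE3EnergyWeightedShapes (energyNormW energyNormW_nonneg)
open NE3ProductPathBounds (energyNormW_sub_le)
open NE3RightInverseSupLetters (frameC)
open NE3AxialGaugeLadder (smallField_gaugeAct)
open NE3SlicePoincareShape (SlicePoincare)
open NE7MeanZeroGaugeSliceW (energyBlockLandauW)
open NE7ConvOneStepWeighted (curlSq_ge_weighted hess_vary_ge_weighted)
open NE7SegmentPlaquetteRadius (smallField_vary_segment_class)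
open NE7OneStepLetters (abs_dAction_le_radius_mul)
open NE7ExactCurrent (dAction_add)
open NE7EtaMinimiserGaugeCovariance (levelAction_gaugeAct)
open NE7PairDecompNL0SupGeneric (decomp_of_nl0_pair_sup_generic)
open NE7PairCovGradRate40Generic (covGrad_rate_le_generic)
open NE7EtaRatesD4 (energy_budget_of_residualScale)
open NE7CovGradBootstrapAlgebra (exists_cube_root sq_two_add_rate rate_plain)
open NE3AveragedGradientRadius (norm_plaqGrad_cavg_le_of_regularSup norm_plaqGrad_gaugeAct')
open NE3FluxGradientDictionary (norm_Ad_hol_sub_hol_le_of_fluxGrad)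
open MinimalActionRefine (RegularSup)
open BlockAverageCurrent (curConst curConst_nonneg)
open NE7EnergySliceSpikeResidual (energyNormW_spike_sq_le spike_tangent_data abs_dAction_le_of_regular_slice)
open BlockAveragePushDirGauge (gaugeDir)
open NE3CornerSpikes (spikeW)
open NE3TangentCovariantTower (framePotW)

open NE7EnergyRateWPrep (wallConst_pos spike_coef_le spike_energy_le two_sided_ineq rate_algebra ratio_le_of_lower)
open NE7EnergyRateWGeneric (line_of_small_card kfree_coercivity_card)
open NE7EnergyRateWPrepGeneric (dualC2_pos residualScale_lower cavg_admissible)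

noncomputable section

set_option maxHeartbeats 1600000 in
/-- **T-E_w♯ TOGETHER WITH (Gᶜ_w), `d = 4`, ANY BLOCK SIZE `L ≥ 2`, ANY `U(n)`, MODULO THE LOG-TOLERANT FLUX-GRADIENT LETTERS OF THE TWO MINIMISERS AND THE CLASS DISPLAYS AT
BLOCK SIZE `L`** (statement and argument in the file header). [folklore] -/
theorem ne3EnergyGradRateWSup_log_L {n : Type} [Fintype n] [DecidableEq n] [Nonempty n] {L : ℕ} (hL : 2 ≤ L) {CP₀ ε₁ : ℝ} (hCP₀0 : 0 ≤ CP₀)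
    (hε₁ : 0 < ε₁) (hε₁cap : 512 * (((4 : ℕ) : ℝ) + 1) * (((4 : ℕ) : ℝ) + 4) * (L : ℝ) ^ 2 * ε₁ ≤ 1)
    (hls : ∀ {ε : ℝ}, 0 ≤ ε → ε ≤ ε₁ → ∀ k : ℕ, LevelSmall 4 L k (ε / ((L : ℝ) ^ (k + 1)) ^ 2))
    (hPclass : ∀ (N : ℕ) [NeZero N], 1 ≤ N → ∀ ε : ℝ, 0 < ε → ε ≤ ε₁ → ∀ (j : ℕ) (W : Site 4 → Fin 4 → (Matrix n n ℂ)ˣ),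
      W ∈ sfClass 4 L N ε (j + 1) →
        SlicePoincare L (j + 1) W (energyBlockLandauW (d := 4) (n := n) L N (j + 1) W) CP₀ (periodBox (d := 4) (N * L ^ (j + 1)))) :
    ∃ ε₀ : ℝ, 0 < ε₀ ∧ ∀ ε : ℝ, 0 < ε → ε ≤ ε₀ → ∀ b g c : ℝ, 0 ≤ b → b + 226 * 320 ^ 2 * (L : ℝ) ^ 2 * b ^ 2 ≤ ε → 0 < g → 0 ≤ c →
      ∀ θ : ℝ, 0 < θ → θ ^ 18 = ((L : ℝ))⁻¹ →
      ∃ C s : ℝ, 0 ≤ C ∧ 0 ≤ s ∧ ∀ (N : ℕ) [NeZero N], ∃ ΛG : ℝ, 0 ≤ ΛG ∧ ∀ (dom : Set (Site 4 → Fin 4 → (Matrix n n ℂ)ˣ)),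
        ∀ k : ℕ, 1 ≤ k → ∀ V ∈ dom, ∀ UA UB : Site 4 → Fin 4 → (Matrix n n ℂ)ˣ,
          IsMinimiser 4 (sfClass 4 L N ε) L N k V UA → IsMinimiser 4 (sfClass 4 L N ε) L N (k + 1) V UB → Regular 4 L N b g (k + 1) UB →
          (∀ (x : Site 4) (κ : Fin 4) (π : T4AveragingDeficitWall.Plane 4), ‖T4AveragingDeficitWall.covGrad UA (T4AveragingDeficitWall.flux UA) x κ π‖
              ≤ c * (1 + (k : ℝ)) / ((L : ℝ) ^ k) ^ 3) →
          (∀ (x : Site 4) (κ : Fin 4) (π : T4AveragingDeficitWall.Plane 4), ‖T4AveragingDeficitWall.covGrad UB (T4AveragingDeficitWall.flux UB) x κ π‖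
              ≤ c * (1 + ((k + 1 : ℕ) : ℝ)) / ((L : ℝ) ^ (k + 1)) ^ 3) →
          ∃ (u : Site 4 → (Matrix n n ℂ)ˣ) (Z : Site 4 → Fin 4 → Matrix n n ℂ),
            IsUnitarySite u ∧ IsPeriodicSite u ((N * L ^ k : ℕ) : ℤ) ∧
            IsSkewDir Z ∧ IsPeriodicDir Z ((N * L ^ k : ℕ) : ℤ) ∧
            gaugeAct u UA = vary (rescale L (bavg L UB)) Z 1 ∧
            energyNormW L k (rescale L (bavg L UB)) Z (periodBox (N * L ^ k)) ≤ C * residualScale 4 L N b g k ∧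
            (∀ (x : Site 4) (κ : Fin 4), ‖Z x κ‖ ≤ s * (((L : ℝ))⁻¹) ^ k) ∧
            (∀ (κ : Fin 4) (x : Site 4) (μ : Fin 4),
              ‖T4AveragingDeficitWall.Ad (rescale L (bavg L UB) (x + e κ) μ) (Z (x + e μ) κ) - Z x κ‖ ≤ ΛG * θ ^ (38 * k)) := by
  have hL1 : 1 ≤ L := Nat.le_trans (by norm_num) hL
  haveI : NeZero L := ⟨by omega⟩
  have hL0 : (0 : ℝ) < L := by exact_mod_cast hL1
  have hLr1 : (1 : ℝ) ≤ L := by exact_mod_cast hL1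
  obtain ⟨ε₂, hε₂, CS, hCS, νc, hνc, κc, hκc, cN, hcN, hdec⟩ := decomp_of_nl0_pair_sup_generic (n := n) hL
  obtain ⟨KG, hKG, εG, hεG, hcov⟩ := covGrad_rate_le_generic (n := n) hL
  -- the k-free coercivity budget (`line_of_small_card`), Poincaré constant `CP = CP₀ + 1`, `c = card n`
  obtain ⟨cn, hcn⟩ : ∃ cn : ℝ, cn = (Fintype.card n : ℝ) := ⟨_, rfl⟩
  have hcn1 : 1 ≤ cn := by rw [hcn]; exact_mod_cast Fintype.card_pos
  have hcn0 : 0 < cn := by linarith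
  obtain ⟨CP, hCP⟩ : ∃ CP : ℝ, CP = CP₀ + 1 := ⟨_, rfl⟩
  have hCP0 : 0 ≤ CP := by rw [hCP]; linarith
  obtain ⟨Q, hQ⟩ : ∃ Q : ℝ, Q = 2 * (1 + CP) := ⟨_, rfl⟩
  have hQ4 : 4 ≤ Q := by rw [hQ, hCP]; linarith
  obtain ⟨cL, hcL⟩ : ∃ cL : ℝ, cL = 2 * κc + νc ^ 2 + 2304 * (CS ^ 2 * Real.exp (2 * CS)) + 112 * (1 + 7 * CS ^ 2) + 1 := ⟨_, rfl⟩
  have hcL0 : 0 < cL := by rw [hcL]; positivity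
  obtain ⟨ε₃, hε₃⟩ : ∃ ε₃ : ℝ, ε₃ = (1 / 2) / Q / 4 / cn / cL := ⟨_, rfl⟩
  have hε₃0 : 0 < ε₃ := by rw [hε₃]; positivity
  have hcard : (0 : ℝ) < 1000000000000000000000 * (L : ℝ) ^ 6 * (Fintype.card n : ℝ) := by rw [← hcn]; positivity
  -- the (Gᶜ_w) regime: `ε ≤ ε_G` (curved letter), `C_S ε ≤ 1∕48`, the (Rb) line `2¹⁵·5²·8²·L²·ε ≤ 1` of `NE3AveragedGradientRadius`, `ε ≤ 1∕4`
  have h48 : (0 : ℝ) < 1 / (48 * CS) := by positivity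
  have hRb0 : (0 : ℝ) < 1 / (2 ^ 15 * (((4 : ℕ) : ℝ) + 1) ^ 2 * (((4 : ℕ) : ℝ) + 4) ^ 2 * (L : ℝ) ^ 2) := by positivity
  refine ⟨min (min ε₂ (min ε₁ (min (1 / (1000000000000000000000 * (L : ℝ) ^ 6 * (Fintype.card n : ℝ))) (min ε₃ 1))))
      (min εG (min (1 / (48 * CS)) (min (1 / (2 ^ 15 * (((4 : ℕ) : ℝ) + 1) ^ 2 * (((4 : ℕ) : ℝ) + 4) ^ 2 * (L : ℝ) ^ 2)) (1 / 4)))),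
    lt_min (lt_min hε₂ (lt_min hε₁ (lt_min (by positivity) (lt_min hε₃0 one_pos)))) (lt_min hεG (lt_min h48 (lt_min hRb0 (by norm_num)))), ?_⟩
  intro ε hε hεle0 b g c hb hbq hg hc θ hθ hθ18
  have hεle := hεle0.trans (min_le_left _ _)
  have hεεG : ε ≤ εG := hεle0.trans ((min_le_right _ _).trans (min_le_left _ _))
  have hε48 : CS * ε ≤ 1 / 48 := by
    have h := hεle0.trans ((min_le_right _ _).trans ((min_le_right _ _).trans (min_le_left _ _)))
    rw [le_div_iff₀ (by positivity)] at h; linarith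
  have hRb : 2 ^ 15 * (((4 : ℕ) : ℝ) + 1) ^ 2 * (((4 : ℕ) : ℝ) + 4) ^ 2 * (L : ℝ) ^ 2 * ε ≤ 1 := by
    have h := hεle0.trans ((min_le_right _ _).trans ((min_le_right _ _).trans ((min_le_right _ _).trans (min_le_left _ _))))
    rw [le_div_iff₀ (by positivity)] at h; linarith
  have hε4 : ε ≤ 1 / 4 := hεle0.trans ((min_le_right _ _).trans ((min_le_right _ _).trans ((min_le_right _ _).trans (min_le_right _ _))))
  have hεε₂ : ε ≤ ε₂ := hεle.trans (min_le_left _ _)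
  have hε53 : ε ≤ ε₁ := hεle.trans ((min_le_right _ _).trans (min_le_left _ _))
  have hεθ : ε ≤ 1 / (1000000000000000000000 * (L : ℝ) ^ 6 * (Fintype.card n : ℝ)) :=
    hεle.trans ((min_le_right _ _).trans ((min_le_right _ _).trans (min_le_left _ _)))
  have hεε₃ : ε ≤ ε₃ := hεle.trans ((min_le_right _ _).trans ((min_le_right _ _).trans ((min_le_right _ _).trans (min_le_left _ _))))
  have hε1 : ε ≤ 1 := hεle.trans ((min_le_right _ _).trans ((min_le_right _ _).trans ((min_le_right _ _).trans (min_le_right _ _))))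
  have hθline : 1000000000000000000000 * (L : ℝ) ^ 6 * (Fintype.card n : ℝ) * ε ≤ 1 := by
    rw [le_div_iff₀ hcard] at hεθ; linarith
  -- the [B7] Prop. 1 cap and the level family at this `ε`
  have hcapε : 512 * (((4 : ℕ) : ℝ) + 1) * (((4 : ℕ) : ℝ) + 4) * (L : ℝ) ^ 2 * ε ≤ 1 := by
    have : 512 * (((4 : ℕ) : ℝ) + 1) * (((4 : ℕ) : ℝ) + 4) * (L : ℝ) ^ 2 * ε ≤ 512 * (((4 : ℕ) : ℝ) + 1) * (((4 : ℕ) : ℝ) + 4) * (L : ℝ) ^ 2 * ε₁ :=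
      mul_le_mul_of_nonneg_left hε53 (by positivity)
    exact this.trans hε₁cap
  have hlsε : ∀ k : ℕ, LevelSmall 4 L k (ε / ((L : ℝ) ^ (k + 1)) ^ 2) := hls hε.le hε53
  -- the strict line: `2κ_c ε < cK`, i.e. the gap `γ := cK/2 − κ_c ε > 0`
  have hsmall : cL * ε ≤ (1 / 2) / Q / 4 / cn := by
    have h1 : cL * ε ≤ cL * ε₃ := mul_le_mul_of_nonneg_left hεε₃ hcL0.le
    have h2 : cL * ε₃ = (1 / 2) / Q / 4 / cn := by rw [hε₃]; field_simp
    linarith only [h1, h2]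
  have hline := line_of_small_card hQ4 hcn1 hCS hε hε1 (by rw [← hcL]; exact hsmall)
  obtain ⟨cK, hcK⟩ : ∃ cK : ℝ, cK = ((((1 / 2 - (νc * ε) ^ 2) / Q - (νc * ε) ^ 2) / 2 - 576 * ((4 : ℕ) : ℝ) * ((CS * ε) ^ 2 * Real.exp (2 * (CS * ε)))) / cn
      - 28 * ((4 : ℕ) : ℝ) * (ε + 7 * (CS * ε) ^ 2)) := ⟨_, rfl⟩
  rw [← hcK] at hline
  obtain ⟨γ, hγ⟩ : ∃ γ : ℝ, γ = cK / 2 - κc * ε := ⟨_, rfl⟩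
  have hγ0 : 0 < γ := by rw [hγ]; linarith
  -- the constants of the bound (the (RES♯) constant of `abs_dAction_le_of_regular_slice` at `d = 4`, block size `L`)
  obtain ⟨C', hC'⟩ : ∃ C' : ℝ, C' = (Real.sqrt ((L : ℝ) ^ (4 - 2))
            + (Real.sqrt ((L : ℝ) ^ (4 - 2)) * Real.sqrt (8 * Fintype.card (T4AveragingDeficitWall.Plane 4))
                * (128 * ((4 : ℕ) * (L : ℝ) ^ 2))
              + 2 * (2048 * (((4 : ℕ) : ℝ) + 4) ^ 2 * (L : ℝ) ^ 2 * Real.sqrt ((4 : ℕ) * (L : ℝ) ^ 4))) * b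
            + b ^ 2 * (2 * (L : ℝ) ^ (4 - 1) + 2 * (8 * (4 : ℕ) * (L : ℝ) ^ 4)) * Real.sqrt ((4 : ℕ) / (g * (L : ℝ) ^ (4 + 2)))) := ⟨_, rfl⟩
  have hC'0 : 0 ≤ C' := by rw [hC']; positivity
  obtain ⟨G, hG⟩ : ∃ G : ℝ, G = frameC 4 L * (CS * ε) := ⟨_, rfl⟩
  have hG0 : 0 ≤ G := by rw [hG]; have := NE7FrameFreeRightInverse.frameC_nonneg 4 L; positivity
  obtain ⟨σ, hσ⟩ : ∃ σ : ℝ, σ = Real.sqrt (4 * (Fintype.card (T4AveragingDeficitWall.Plane 4) : ℝ) + 16) * G := ⟨_, rfl⟩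
  have hσ0 : 0 ≤ σ := by rw [hσ]; positivity
  obtain ⟨w₀, hw₀⟩ : ∃ w₀ : ℝ, w₀ = 2 * wallConst 4 L * dualC2 4 L * Real.sqrt g / (L : ℝ) := ⟨_, rfl⟩
  have hw₀0 : 0 < w₀ := by
    rw [hw₀]; exact div_pos (mul_pos (mul_pos (mul_pos two_pos (wallConst_pos 4 L)) (dualC2_pos hL1)) (Real.sqrt_pos.2 hg)) hL0
  obtain ⟨Cfin, hCfin⟩ : ∃ Cfin : ℝ, Cfin = C' * (1 + νc * ε) / γ + Real.sqrt (2 * C' * σ / (γ * w₀)) := ⟨_, rfl⟩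
  have hCfin0 : 0 ≤ Cfin := by rw [hCfin]; positivity
  refine ⟨Cfin, CS * ε, hCfin0, by positivity, ?_⟩
  intro N _
  have hN : 1 ≤ N := Nat.one_le_iff_ne_zero.mpr (NeZero.ne N)
  -- the energy budget `γ_E³ = C·ρ₄(N) + 1` (k-free) and the (Gᶜ_w) constant
  obtain ⟨γE, hγEpos, hγE3⟩ := exists_cube_root
    (show 0 < Cfin * (wallConst 4 L * (N : ℝ) ^ 2 * (Real.sqrt g * dualC2 4 L + 2 * b ^ 2 * dualC1 4 L)) + 1 by
      have := wallConst_nonneg 4 L; have := dualC1_nonneg 4 L; have := dualC2_nonneg 4 L; positivity)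
  have hθ1 : θ < 1 := NE7EtaClosenessHolder.theta18_lt_one hL hθ18
  have hD0 : 0 ≤ (1 - θ)⁻¹ := inv_nonneg.mpr (by linarith)
  have hcur := curConst_nonneg (d := 4) L
  refine ⟨4 * (32 * KG * (max γE (max 1 (10 * c + 6 * curConst 4 L * ε ^ 2 + 8 * (CS * ε) * ε + 4096 * (CS * ε) ^ 2 * ε + 1330 * (CS * ε) ^ 3))) ^ 2 * γE * (1 - θ)⁻¹)
        * ((1 - θ)⁻¹) ^ 2
      + 2 ^ 27 * (CS * ε) ^ 2 * KG ^ 3 * γE ^ 3 * ((1 - θ)⁻¹) ^ 3 + 2 * (KG * cN * γE ^ 6 * (1 - θ)⁻¹ + 2 * cN * γE ^ 6), by positivity, ?_⟩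
  intro dom k hk V _ UA UB hA hB hreg hgA0 hgB0
  obtain ⟨j, rfl⟩ : ∃ j, k = j + 1 := ⟨k - 1, by omega⟩
  -- the dominating letter `c′ := c·(2 + k)` of BOTH minimisers at this level
  set c' : ℝ := c * (2 + ((j + 1 : ℕ) : ℝ)) with hc'
  have hk2 : (1 : ℝ) ≤ 2 + ((j + 1 : ℕ) : ℝ) := le_add_of_le_of_nonneg (by norm_num) (by positivity)
  have hc'0 : 0 ≤ c' := by rw [hc']; positivity
  have hcc' : c * (1 + ((j + 1 : ℕ) : ℝ)) ≤ c' := by rw [hc']; nlinarith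
  have hgA : ∀ (x : Site 4) (κ : Fin 4) (π : T4AveragingDeficitWall.Plane 4), ‖T4AveragingDeficitWall.covGrad UA (T4AveragingDeficitWall.flux UA) x κ π‖
      ≤ c' / ((L : ℝ) ^ (j + 1)) ^ 3 := fun x κ π =>
    (hgA0 x κ π).trans (div_le_div_of_nonneg_right hcc' (by positivity))
  have hgB : ∀ (x : Site 4) (κ : Fin 4) (π : T4AveragingDeficitWall.Plane 4), ‖T4AveragingDeficitWall.covGrad UB (T4AveragingDeficitWall.flux UB) x κ π‖
      ≤ c' / ((L : ℝ) ^ (j + 1 + 1)) ^ 3 := fun x κ π =>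
    (hgB0 x κ π).trans (le_of_eq (by rw [hc']; push_cast; ring))
  have hB' : IsMinimiser 4 (sfClass 4 L N ε) L N (j + 2) V UB := hB
  have hreg' : Regular 4 L N b g (j + 2) UB := hreg
  -- the competitor `W := cavg L U_B` and its class data
  obtain ⟨hbε, hs1, hs2, hWu, hWP, hWx, hWadm⟩ := cavg_admissible (N := N) hL j hε hcapε hlsε hb hbq hB' hreg'
  have htow : ((tower L N (j + 1) : ℕ) : ℤ) = ((N * L ^ (j + 1) : ℕ) : ℤ) := by rw [NE3EnergyRateWSupOfSlicePoincare.tower_eq_mul_pow]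
  have hWPt : IsPeriodicCfg (cavg L UB) ((tower L N (j + 1) : ℕ) : ℤ) := by rw [htow]; exact hWP
  have hM0 : (0 : ℝ) < (L : ℝ) ^ (j + 1) := by positivity
  have hM1 : (1 : ℝ) ≤ (L : ℝ) ^ (j + 1) := one_le_pow₀ hLr1
  have hx : 0 ≤ ε / ((L : ℝ) ^ (j + 1)) ^ 2 := by positivity
  -- the pair decomposition in the slice gauge
  obtain ⟨u, X, XT, XN, α, ν, κ, hu, huP, hXs, hXP, hα, hXα, hgauge, hXdec, hXT, hframe, hXN, hν, hNw, hN1, hαM, hνle, hκle, hNs, hNc⟩ :=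
    hdec N ε hε hεε₂ hθline V j (cavg L UB) hWadm UA hA.mem
  have hE0 := energyNormW_nonneg L (j + 1) (cavg L UB) X (periodBox (d := 4) (N * L ^ (j + 1)))
  -- (1) the weighted Poincaré letter on the class (constant `CP₀ ≤ CP`)
  have hP0 := hPclass N hN ε hε hε53 j (cavg L UB) ⟨hWu, hWP, hWx⟩
  have hP := NE3SlicePoincareShape.slicePoincare_mono hP0 (show CP₀ ≤ CP by rw [hCP]; linarith)
  have hNw2 : energyNormW L (j + 1) (cavg L UB) XN (periodBox (d := 4) (N * L ^ (j + 1))) ^ 2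
      ≤ ν ^ 2 * energyNormW L (j + 1) (cavg L UB) X (periodBox (d := 4) (N * L ^ (j + 1))) ^ 2 := by
    have h0 := energyNormW_nonneg L (j + 1) (cavg L UB) XN (periodBox (d := 4) (N * L ^ (j + 1)))
    calc _ ≤ (ν * energyNormW L (j + 1) (cavg L UB) X (periodBox (d := 4) (N * L ^ (j + 1)))) ^ 2 := pow_le_pow_left₀ h0 hNw 2
      _ = _ := by ring
  have hm := curlSq_ge_weighted (L := L) (k := j + 1) hCP0 hP hXdec hXT hNw2
  -- (2) the plaquette radius along the segment, (3) the convexity letter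
  have h1 : SmallField (vary (cavg L UB) X 1) (ε / ((L : ℝ) ^ (j + 1)) ^ 2) := by
    rw [← hgauge]; exact smallField_gaugeAct hu hA.mem.1.2.2
  have hrad : ∀ t ∈ Icc (0 : ℝ) 1, SmallField (vary (cavg L UB) X t) (ε / ((L : ℝ) ^ (j + 1)) ^ 2 + 7 * α ^ 2) := fun t ht =>
    smallField_vary_segment_class hWu hXs hWx h1 hXα ht
  have ha' : 0 ≤ ε / ((L : ℝ) ^ (j + 1)) ^ 2 + 7 * α ^ 2 := by positivity
  have hNM : 1 ≤ N * L ^ (j + 1) := Nat.mul_pos (by omega) (Nat.pow_pos (by omega))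
  have hconv : ∀ t ∈ Icc (0 : ℝ) 1,
      ((((1 / 2 - ν ^ 2) / (2 * (1 + CP)) - ν ^ 2) / 2 - 576 * ((4 : ℕ) : ℝ) * (Real.exp α - 1) ^ 2 * ((L : ℝ) ^ (j + 1)) ^ 2)
            / (Fintype.card n : ℝ)
          - 28 * ((4 : ℕ) : ℝ) * (ε / ((L : ℝ) ^ (j + 1)) ^ 2 + 7 * α ^ 2) * ((L : ℝ) ^ (j + 1)) ^ 2)
          * energyNormW L (j + 1) (cavg L UB) X (periodBox (d := 4) (N * L ^ (j + 1))) ^ 2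
        ≤ hess (vary (cavg L UB) X t) X X (perWin 4 (N * L ^ (j + 1))) := fun t ht =>
    hess_vary_ge_weighted (d := 4) (L := L) (k := j + 1) hL1 hNM hWu hXs hXP hα hXα hm ht ha' (hrad t ht)
  -- the k-free minorant `cK ≤ c_k`
  have hck : cK ≤ ((((1 / 2 - ν ^ 2) / (2 * (1 + CP)) - ν ^ 2) / 2 - 576 * ((4 : ℕ) : ℝ) * (Real.exp α - 1) ^ 2 * ((L : ℝ) ^ (j + 1)) ^ 2)
            / (Fintype.card n : ℝ)
          - 28 * ((4 : ℕ) : ℝ) * (ε / ((L : ℝ) ^ (j + 1)) ^ 2 + 7 * α ^ 2) * ((L : ℝ) ^ (j + 1)) ^ 2) := by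
    rw [← hcn, hcK, hQ]
    exact kfree_coercivity_card hcn0 hCP0 hM1 hν hνle hα hαM
  -- (4) Taylor along the segment and (5) minimality of `U_A` against the admissible `W`
  obtain ⟨hd1, hd2⟩ := segment_derivData (cavg L UB) X (perWin 4 (N * L ^ (j + 1)))
  have htaylor := taylor_lower hd1 hd2 (fun t ht => (mul_le_mul_of_nonneg_right hck (sq_nonneg _)).trans (hconv t ht))
  rw [T4AveragingDeficitWall.vary_zero] at htaylor
  have hmin : fineAction (vary (cavg L UB) X 1) (perWin 4 (N * L ^ (j + 1))) ≤ fineAction (cavg L UB) (perWin 4 (N * L ^ (j + 1))) := by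
    have hle := hA.le (cavg L UB) hWadm
    rw [← levelAction_gaugeAct L N (j + 1) u UA, hgauge] at hle
    unfold levelAction at hle
    have hw : 0 < ((MinimalActionLevels.stepWt 4 L)⁻¹) ^ (j + 1) := pow_pos (inv_pos.mpr (stepWt_pos (d := 4) L hL1)) _
    exact le_of_mul_le_mul_left hle hw
  -- (6) the split of the first variation: the normal part's curl letter
  have hsplit : dAction (cavg L UB) X (perWin 4 (N * L ^ (j + 1)))
      = dAction (cavg L UB) XT (perWin 4 (N * L ^ (j + 1))) + dAction (cavg L UB) XN (perWin 4 (N * L ^ (j + 1))) := by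
    conv_lhs => rw [hXdec]
    exact dAction_add _ _ _ _
  have hNpart : |dAction (cavg L UB) XN (perWin 4 (N * L ^ (j + 1)))| ≤ κ * energyNormW L (j + 1) (cavg L UB) X (periodBox (d := 4) (N * L ^ (j + 1))) ^ 2 :=
    (abs_dAction_le_radius_mul hWu hXN hWx (perWin 4 (N * L ^ (j + 1)))).trans hN1
  -- (7)–(8) (RES♯) on the slice part, with the spike's weighted energy
  have hres := abs_dAction_le_of_regular_slice (n := n) (d := 4) (by norm_num) hL1 hN j hb hbε hg hs2 hB' hreg'
    hWu hWPt hx hs1 hWx hXT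
  obtain ⟨-, -, -, hfP, -⟩ := spike_tangent_data (N := N) hL1 j hWu hWPt hx hs1 hWx hXT
  have hS2 := energyNormW_spike_sq_le (d := 4) hL1 hN j hWu hWx hfP hframe
  have hES0 := energyNormW_nonneg L (j + 1) (cavg L UB) (gaugeDir (cavg L UB) (spikeW (L ^ (j + 1)) (framePotW L (j + 1) (cavg L UB) XT)))
      (periodBox (d := 4) (N * L ^ (j + 1)))
  have hET := energyNormW_sub_le L (j + 1) (cavg L UB) X XN (periodBox (d := 4) (N * L ^ (j + 1)))
  have hXTeq : XT = X - XN := eq_sub_of_add_eq hXdec.symm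
  rw [← hXTeq] at hET
  have hρlow := residualScale_lower hL1 N j (b := b) hg.le
  have hρ0 := residualScale_nonneg 4 L N b g (j + 1)
  set M : ℝ := (L : ℝ) ^ (j + 1) with hM
  set E : ℝ := energyNormW L (j + 1) (cavg L UB) X (periodBox (d := 4) (N * L ^ (j + 1))) with hE
  set ET : ℝ := energyNormW L (j + 1) (cavg L UB) XT (periodBox (d := 4) (N * L ^ (j + 1))) with hETdef
  set EN : ℝ := energyNormW L (j + 1) (cavg L UB) XN (periodBox (d := 4) (N * L ^ (j + 1))) with hENdef
  set ES : ℝ := energyNormW L (j + 1) (cavg L UB) (gaugeDir (cavg L UB) (spikeW (L ^ (j + 1)) (framePotW L (j + 1) (cavg L UB) XT)))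
      (periodBox (d := 4) (N * L ^ (j + 1))) with hESdef
  set ρ : ℝ := residualScale 4 L N b g (j + 1) with hρ
  set P : ℝ := (Fintype.card (T4AveragingDeficitWall.Plane 4) : ℝ) with hPdef
  have hP0' : 0 ≤ P := by rw [hPdef]; positivity
  -- `hres` in the abstract currency: `|dAction W X_T| ≤ C'ρ (ET + ES)`
  have hres' : |dAction (cavg L UB) XT (perWin 4 (N * L ^ (j + 1)))| ≤ C' * ρ * (ET + ES) := by rw [hC']; exact hres
  have hr0 : 0 ≤ C' * ρ := mul_nonneg hC'0 hρ0
  -- the spike's weighted energy: `ES ≤ σ·N²/M`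
  have hESle : ES ≤ σ * ((N : ℝ) ^ 2 / M) := by
    have h := spike_energy_le hES0 hG0 hM0 hP0' (by rw [hG]; exact hS2)
      (spike_coef_le hM1 hε.le hε1 hP0')
    rw [hσ, hPdef]; simpa only [mul_assoc] using h
  -- (9) the two-sided inequality `γ E² ≤ C'ρ(1+ν_c ε)·E + C'ρ·σ·N²/M`
  have hkey : dAction (cavg L UB) X (perWin 4 (N * L ^ (j + 1))) + cK * E ^ 2 / 2 ≤ 0 := by linarith only [htaylor, hmin]
  have hETle : ET ≤ (1 + νc * ε) * E := by
    have : EN ≤ νc * ε * E := hNw.trans (mul_le_mul_of_nonneg_right hνle hE0)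
    linarith only [hET, this]
  have hTpart : |dAction (cavg L UB) XT (perWin 4 (N * L ^ (j + 1)))| ≤ C' * ρ * ((1 + νc * ε) * E + σ * ((N : ℝ) ^ 2 / M)) :=
    hres'.trans (mul_le_mul_of_nonneg_left (by linarith only [hETle, hESle]) hr0)
  have hγE : γ * E ^ 2 ≤ C' * ρ * (1 + νc * ε) * E + C' * ρ * (σ * ((N : ℝ) ^ 2 / M)) := by
    rw [hγ]; exact two_sided_ineq hkey hsplit hNpart hTpart hκle
  -- (10) `N²/M ≤ 2ρ/w₀` (the weight `w₀ = 2·wallConst·dualC2·√g/L` turns `w₀N²/(2M)` into `wallConst·dualC2·√g·N²/(L·M)`) and the final bookkeeping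
  have hρlow' : w₀ * (N : ℝ) ^ 2 / (2 * M) ≤ ρ := by
    have e : w₀ * (N : ℝ) ^ 2 / (2 * M) = wallConst 4 L * dualC2 4 L * Real.sqrt g * (N : ℝ) ^ 2 / ((L : ℝ) * M) := by
      rw [hw₀]; field_simp
    rw [e]; exact hρlow
  have hNM' : (N : ℝ) ^ 2 / M ≤ 2 * ρ / w₀ := ratio_le_of_lower hM0 hw₀0 hρlow'
  have hfinal : E ≤ Cfin * ρ := by
    rw [hCfin]
    exact rate_algebra hρ0 hγ0 hC'0 (by positivity) hσ0 hw₀0 (by positivity) hNM' hγE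
  -- (11) the sup letter: `‖X(b)‖ ≤ α ≤ C_S ε / M = (C_S ε)·L^{−(j+1)}`
  have hsup : ∀ (x : Site 4) (κ' : Fin 4), ‖X x κ'‖ ≤ CS * ε * (((L : ℝ))⁻¹) ^ (j + 1) := by
    intro x κ'
    have hαle : α ≤ CS * ε / M := by rw [le_div_iff₀ hM0]; exact hαM
    have e : CS * ε * (((L : ℝ))⁻¹) ^ (j + 1) = CS * ε / M := by rw [inv_pow, hM]; ring
    rw [e]; exact (hXα x κ').trans hαle
  -- (12) THE COVARIANT-GRADIENT RATE (Gᶜ_w): budget form of (E), the radii of the pair, and `covGrad_rate_le_generic`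
  have hEγ : (L : ℝ) ^ (j + 1) * E ≤ γE ^ 3 := by
    have h := energy_budget_of_residualScale (L := L) hL1 N b hg.le hCfin0 (j + 1) hfinal
    rw [hγE3]; linarith
  -- the plaquette-gradient radius of `W = cavg U_B` from the flux-gradient letter of `U_B` (level `j+2`)
  have hregB : RegularSup 4 L N ε c' (j + 2) UB := ⟨hB.mem.1.1, hB.mem.1.2.1, hB.mem.1.2.2, hgB⟩
  have hx₁W : ∀ (p : Site 4) (lam μ' ν' : Fin 4), μ' ≠ ν' →
      ‖T4AveragingDeficitWall.Ad (cavg L UB p lam) ((hol (cavg L UB) (p + e lam) (plaqWord μ' ν') : (Matrix n n ℂ)ˣ) : Matrix n n ℂ)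
          - ((hol (cavg L UB) p (plaqWord μ' ν') : (Matrix n n ℂ)ˣ) : Matrix n n ℂ)‖ ≤ 2 * (c' + curConst 4 L * ε ^ 2) / ((L : ℝ) ^ (j + 1)) ^ 3 :=
    fun p lam μ' ν' hne => norm_plaqGrad_cavg_le_of_regularSup (d := 4) hL1 hregB hε.le (by push_cast at hRb ⊢; exact hRb) p lam hne
  -- the plaquette-gradient radius of `U_A^{u} = W e^{X}` from the flux-gradient letter of `U_A` (gauge covariance)
  have hx₁U : ∀ (p : Site 4) (lam μ' ν' : Fin 4), μ' ≠ ν' →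
      ‖T4AveragingDeficitWall.Ad (vary (cavg L UB) X 1 p lam) ((hol (vary (cavg L UB) X 1) (p + e lam) (plaqWord μ' ν') : (Matrix n n ℂ)ˣ) : Matrix n n ℂ)
          - ((hol (vary (cavg L UB) X 1) p (plaqWord μ' ν') : (Matrix n n ℂ)ˣ) : Matrix n n ℂ)‖ ≤ 2 * c' / ((L : ℝ) ^ (j + 1)) ^ 3 := by
    intro p lam μ' ν' hne
    rw [← hgauge, norm_plaqGrad_gaugeAct' hu p lam μ' ν']
    have ha : ε / ((L : ℝ) ^ (j + 1)) ^ 2 ≤ 1 / 4 := (div_le_self hε.le (one_le_pow₀ hM1)).trans hε4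
    have h := norm_Ad_hol_sub_hol_le_of_fluxGrad hA.mem.1.1 hA.mem.1.2.2 ha hgA p lam hne
    exact h.trans (le_of_eq (by ring))
  have hG := hcov 40 (by norm_num) N j ε (CS * ε) c' cN hε hεεG (by positivity) hε48 hc'0 hcN (cavg L UB) hWu hWP hWx hs1 X XT XN hXs hXP hXdec hXT α hXα hαM h1
    γE hγEpos hEγ hNs hNc hx₁W hx₁U θ hθ hθ18
  refine ⟨u, X, hu, huP, hXs, hXP, hgauge, hfinal, hsup, fun κ' x' μ' => (hG κ' x' μ').trans ?_⟩
  -- the letter's `(2+k)²` against `θ^{2k}`: `Λ₂⁰(c′) ≤ (2+k)Λ₂⁰(c)`, `l₀(c′) ≤ (2+k)l₀(c)`, `(2+k)²θ^{40k} ≤ 4D²θ^{38k}`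
  set Λc : ℝ := 10 * c + 6 * curConst 4 L * ε ^ 2 + 8 * (CS * ε) * ε + 4096 * (CS * ε) ^ 2 * ε + 1330 * (CS * ε) ^ 3 with hΛc
  have hrest : 0 ≤ 6 * curConst 4 L * ε ^ 2 + 8 * (CS * ε) * ε + 4096 * (CS * ε) ^ 2 * ε + 1330 * (CS * ε) ^ 3 := by positivity
  have hΛc' : 10 * c' + 6 * curConst 4 L * ε ^ 2 + 8 * (CS * ε) * ε + 4096 * (CS * ε) ^ 2 * ε + 1330 * (CS * ε) ^ 3 ≤ (2 + ((j + 1 : ℕ) : ℝ)) * Λc := by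
    have hr := mul_le_mul_of_nonneg_right hk2 hrest
    rw [one_mul] at hr
    have e : (2 + ((j + 1 : ℕ) : ℝ)) * Λc = 10 * c' + (2 + ((j + 1 : ℕ) : ℝ)) * (6 * curConst 4 L * ε ^ 2 + 8 * (CS * ε) * ε + 4096 * (CS * ε) ^ 2 * ε + 1330 * (CS * ε) ^ 3) := by
      rw [hΛc, hc']; ring
    rw [e]; linarith
  set l₀ : ℝ := max γE (max 1 Λc) with hl₀
  have hl₀0 : 0 < l₀ := lt_of_lt_of_le hγEpos (le_max_left _ _)
  have hmax : max γE (max 1 (10 * c' + 6 * curConst 4 L * ε ^ 2 + 8 * (CS * ε) * ε + 4096 * (CS * ε) ^ 2 * ε + 1330 * (CS * ε) ^ 3)) ≤ (2 + ((j + 1 : ℕ) : ℝ)) * l₀ := by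
    refine max_le ?_ (max_le ?_ ?_)
    · calc γE = 1 * γE := (one_mul _).symm
        _ ≤ (2 + ((j + 1 : ℕ) : ℝ)) * l₀ := mul_le_mul hk2 (le_max_left _ _) hγEpos.le (by linarith)
    · calc (1 : ℝ) = 1 * 1 := (one_mul _).symm
        _ ≤ (2 + ((j + 1 : ℕ) : ℝ)) * l₀ := mul_le_mul hk2 ((le_max_left _ _).trans (le_max_right _ _)) zero_le_one (by linarith)
    · exact hΛc'.trans (mul_le_mul_of_nonneg_left ((le_max_right _ _).trans (le_max_right _ _)) (by linarith))
  have hmax0 : 0 ≤ max γE (max 1 (10 * c' + 6 * curConst 4 L * ε ^ 2 + 8 * (CS * ε) * ε + 4096 * (CS * ε) ^ 2 * ε + 1330 * (CS * ε) ^ 3)) :=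
    hγEpos.le.trans (le_max_left _ _)
  have hsq : (max γE (max 1 (10 * c' + 6 * curConst 4 L * ε ^ 2 + 8 * (CS * ε) * ε + 4096 * (CS * ε) ^ 2 * ε + 1330 * (CS * ε) ^ 3))) ^ 2
      ≤ (2 + ((j + 1 : ℕ) : ℝ)) ^ 2 * l₀ ^ 2 := by
    rw [← mul_pow]; exact pow_le_pow_left₀ hmax0 hmax 2
  have hθ40 : 0 ≤ θ ^ (40 * (j + 1)) := pow_nonneg hθ.le _
  -- term 1
  have t1 : 32 * KG * (max γE (max 1 (10 * c' + 6 * curConst 4 L * ε ^ 2 + 8 * (CS * ε) * ε + 4096 * (CS * ε) ^ 2 * ε + 1330 * (CS * ε) ^ 3))) ^ 2 * γE * (1 - θ)⁻¹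
        * θ ^ (40 * (j + 1))
      ≤ 4 * (32 * KG * l₀ ^ 2 * γE * (1 - θ)⁻¹) * ((1 - θ)⁻¹) ^ 2 * θ ^ (38 * (j + 1)) := by
    have h1 : 32 * KG * (max γE (max 1 (10 * c' + 6 * curConst 4 L * ε ^ 2 + 8 * (CS * ε) * ε + 4096 * (CS * ε) ^ 2 * ε + 1330 * (CS * ε) ^ 3))) ^ 2 * γE * (1 - θ)⁻¹
          * θ ^ (40 * (j + 1))
        ≤ (32 * KG * l₀ ^ 2 * γE * (1 - θ)⁻¹) * (2 + ((j + 1 : ℕ) : ℝ)) ^ 2 * θ ^ (40 * (j + 1)) := by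
      have := mul_le_mul_of_nonneg_left hsq (show 0 ≤ 32 * KG * γE * (1 - θ)⁻¹ by positivity)
      have e1 : 32 * KG * (max γE (max 1 (10 * c' + 6 * curConst 4 L * ε ^ 2 + 8 * (CS * ε) * ε + 4096 * (CS * ε) ^ 2 * ε + 1330 * (CS * ε) ^ 3))) ^ 2 * γE * (1 - θ)⁻¹
          = 32 * KG * γE * (1 - θ)⁻¹ * (max γE (max 1 (10 * c' + 6 * curConst 4 L * ε ^ 2 + 8 * (CS * ε) * ε + 4096 * (CS * ε) ^ 2 * ε + 1330 * (CS * ε) ^ 3))) ^ 2 := by ring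
      have e2 : (32 * KG * l₀ ^ 2 * γE * (1 - θ)⁻¹) * (2 + ((j + 1 : ℕ) : ℝ)) ^ 2 = 32 * KG * γE * (1 - θ)⁻¹ * ((2 + ((j + 1 : ℕ) : ℝ)) ^ 2 * l₀ ^ 2) := by ring
      rw [e1, e2]; exact mul_le_mul_of_nonneg_right this hθ40
    exact h1.trans (sq_two_add_rate hθ.le hθ1 (by positivity) (j + 1))
  have t2 := rate_plain (A := 2 ^ 27 * (CS * ε) ^ 2 * KG ^ 3 * γE ^ 3 * ((1 - θ)⁻¹) ^ 3) hθ.le hθ1.le (by positivity) (show 38 ≤ 40 by norm_num) (j + 1)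
  have t3 := rate_plain (A := 2 * (KG * cN * γE ^ 6 * (1 - θ)⁻¹ + 2 * cN * γE ^ 6)) hθ.le hθ1.le (by positivity) (show 38 ≤ 40 by norm_num) (j + 1)
  have e : (32 * KG * (max γE (max 1 (10 * c' + 6 * curConst 4 L * ε ^ 2 + 8 * (CS * ε) * ε + 4096 * (CS * ε) ^ 2 * ε + 1330 * (CS * ε) ^ 3))) ^ 2 * γE * (1 - θ)⁻¹
        + 2 ^ 27 * (CS * ε) ^ 2 * KG ^ 3 * γE ^ 3 * ((1 - θ)⁻¹) ^ 3 + 2 * (KG * cN * γE ^ 6 * (1 - θ)⁻¹ + 2 * cN * γE ^ 6)) * θ ^ (40 * (j + 1))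
      = 32 * KG * (max γE (max 1 (10 * c' + 6 * curConst 4 L * ε ^ 2 + 8 * (CS * ε) * ε + 4096 * (CS * ε) ^ 2 * ε + 1330 * (CS * ε) ^ 3))) ^ 2 * γE * (1 - θ)⁻¹
          * θ ^ (40 * (j + 1))
        + 2 ^ 27 * (CS * ε) ^ 2 * KG ^ 3 * γE ^ 3 * ((1 - θ)⁻¹) ^ 3 * θ ^ (40 * (j + 1))
        + 2 * (KG * cN * γE ^ 6 * (1 - θ)⁻¹ + 2 * cN * γE ^ 6) * θ ^ (40 * (j + 1)) := by ring
  rw [e]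
  have e' : (4 * (32 * KG * l₀ ^ 2 * γE * (1 - θ)⁻¹) * ((1 - θ)⁻¹) ^ 2 + 2 ^ 27 * (CS * ε) ^ 2 * KG ^ 3 * γE ^ 3 * ((1 - θ)⁻¹) ^ 3
        + 2 * (KG * cN * γE ^ 6 * (1 - θ)⁻¹ + 2 * cN * γE ^ 6)) * θ ^ (38 * (j + 1))
      = 4 * (32 * KG * l₀ ^ 2 * γE * (1 - θ)⁻¹) * ((1 - θ)⁻¹) ^ 2 * θ ^ (38 * (j + 1))
        + 2 ^ 27 * (CS * ε) ^ 2 * KG ^ 3 * γE ^ 3 * ((1 - θ)⁻¹) ^ 3 * θ ^ (38 * (j + 1))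
        + 2 * (KG * cN * γE ^ 6 * (1 - θ)⁻¹ + 2 * cN * γE ^ 6) * θ ^ (38 * (j + 1)) := by ring
  rw [e']
  linarith

end

end Summit.QuantumFields.BalabanUV.T4Continuum.NE7EnergyGradRateWLogGeneric
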